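import Literature.Computability.QuantumComplexity.JonesPolynomial
import Literature.Computability.Cryptography.ClassBQP
import HarnessLib

/-!
# The plat-closure Jones polynomial at `e^{2πi/5}`: in `PromiseBQP` (AJL) and `PromiseBQP`-hard (FLW; Aharonov–Arad)

Named fact (D-0014) requested by route QuantumAdvantage/PromiseLift, crux #3 (`wi-03991`,
superseding `wi-03603`), over the landed `Literature.Computability.QuantumComplexity.jonesApproxProblem`
(`JonesPolynomial.lean`) and `Literature.Computability.Cryptography.PromiseBQP` (`ClassBQP.lean`).

**Source.** D. Aharonov, V. Jones, Z. Landau, *A polynomial quantum algorithm for approximating the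
Jones polynomial*, Algorithmica 55 (2009) 395–421, Thm. 1.2 (plat closure): for every `k` there is a
quantum algorithm which, given an `n`-strand braid word `b` with `m` crossings and `ε > 0`, outputs
in time `poly(n, m, k, 1/ε)` with all but exponentially small probability an additive approximation
of `V_{b^{pl}}(e^{2πi/k})` to within `ε · d^{n/2 - 1}` (`d = 2 cos(π/k)`; §3 for the precision and
running-time bookkeeping — the Hadamard test on the path-model representation of `B_n` at
`A = i e^{-iπ/2k}`). Normalising by `d^{n/2-1}` (Aharonov–Arad 2011, §1) and thresholding at
`θ + 1/(2·prec)` with `ε = 1/(3·prec)` decides the promise problem `jonesApproxProblem` (YES: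
`|V|/d^{n/2-1} ≥ θ + 1/prec`, NO: `≤ θ`, `prec` unary so `1/ε` is polynomial in the input length)
with error `≤ 1/3`; compiling to a poly-time UNIFORM oracle-free Clifford+T family (Solovay–Kitaev)
puts it in the tree's `PromiseBQP` at `k = 5`. We record exactly the requested membership
(`wi-03991`).

**Hardness** (`wi-03997`, superseding `wi-03604`). Freedman–Larsen–Wang (Comm. Math. Phys. 227/228
(2002): universality of the `SU(2)` Chern–Simons modular functor at level `3`, i.e. `k = 5`) and,
explicitly for the plat-closure additive approximation, Aharonov–Arad (New J. Phys. 13 (2011),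
Thm. 1.1 and §1: BQP-hardness for all `k ≥ 5`, `k ≠ 6`, and `k = poly(n)`): given a uniform
polynomial-size quantum circuit family and an input `x`, one computes in polynomial time an even
`n`, a braid word `b ∈ B_n` and a threshold `(θ, prec)` such that acceptance probability `≥ 2/3`
forces `|V_{b^{pl}}(e^{2πi/5})|/d^{n/2-1} ≥ θ + 1/prec` and `≤ 1/3` forces `≤ θ` (density of the
path-model representation of `B_n` at `k = 5`, four-strand qubit encoding, Solovay–Kitaev). In the
tree's vocabulary: every `Q ∈ PromiseBQP` Karp-reduces (`PromiseProblem.PolyTimeReducible`,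
`Promise.lean`) to `jonesApproxProblem`.

## References

* D. Aharonov, V. Jones, Z. Landau, Algorithmica 55 (2009) 395–421, Thm. 1.2 and §3
  [AharonovJonesLandau2009].
* D. Aharonov, I. Arad, *The BQP-hardness of approximating the Jones polynomial*, New J. Phys. 13
  (2011), Thm. 1.1 and §1 [AharonovArad2011].
* M. Freedman, M. Larsen, Z. Wang, *A modular functor which is universal for quantum computation*,
  Comm. Math. Phys. 227 (2002) 605–622 [FreedmanLarsenWang2002].
-/

namespace Literature.Computability.QuantumComplexity

/-- **Aharonov–Jones–Landau (2009), Thm. 1.2 (plat closure), decision form at `k = 5`:** the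
threshold promise problem for the normalised plat-closure Jones polynomial at `e^{2πi/5}` lies in
`PromiseBQP` (poly-time uniform oracle-free Clifford+T circuits, completeness `≥ 2/3`, soundness
`≤ 1/3`). [cite: AharonovJonesLandau2009, Thm. 1.2 and §3] [cite: AharonovArad2011, §1 (normalisation)] -/
def ajl_jonesApproxProblem_mem_PromiseBQP : Prop :=
  jonesApproxProblem ∈ Cryptography.PromiseBQP

/-- **Freedman–Larsen–Wang (2002) / Aharonov–Arad (2011), Thm. 1.1: `PromiseBQP`-hardness of the
Jones approximation at `k = 5`.** Every promise problem in `PromiseBQP` polynomial-time Karp-reduces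
to `jonesApproxProblem`. [cite: AharonovArad2011, Thm. 1.1 and §1] [cite: FreedmanLarsenWang2002, main theorem (universality at level 3)] -/
def flw_jonesApproxProblem_hard : Prop :=
  ∀ Q ∈ Cryptography.PromiseBQP, Q.PolyTimeReducible jonesApproxProblem

/-- Together: `jonesApproxProblem` is `PromiseBQP`-complete under Karp reductions of promise
problems. [folklore] -/
theorem jonesApproxProblem_complete (h₁ : ajl_jonesApproxProblem_mem_PromiseBQP)
    (h₂ : flw_jonesApproxProblem_hard) :
    jonesApproxProblem ∈ Cryptography.PromiseBQP ∧ ∀ Q ∈ Cryptography.PromiseBQP, Q.PolyTimeReducible jonesApproxProblem :=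
  ⟨h₁, h₂⟩

end Literature.Computability.QuantumComplexity
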